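import Literature.AlgebraicGeometry.Motives.GrothendieckComplexH0Projective
import HarnessLib

/-!
# The matrix of a map of finite projective modules computes the kernels of all its base changes, naturally (Görtz–Wedhorn II, Cor. 23.137)

`Motives/GrothendieckComplexH0Projective` proves (`exists_matrix_forall_ker_equiv_ker_baseChange`)
that for a linear map `d : P₀ → P₁` of finitely generated projective modules over a commutative
ring `A` there is a matrix `M ∈ M_{n × m}(A)` with `Ker(M ⊗ B) ≅ Ker(d ⊗ B)` for every
commutative `A`-algebra `B` — the passage from the Grothendieck complex of finitely generated
projective modules (Görtz–Wedhorn II, Cor. 23.135 / Prop. 22.53) to a matrix of functions, without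
shrinking the base. The isomorphisms there are recorded as `Nonempty`. Cor. 23.137 asserts
isomorphisms "functorial in the `A`-algebra `B`", and the applications of the Grothendieck complex
that compare two base changes (restriction from an open to a smaller open, or to a point:
`grothendieckComplex_sectionsOver_basicOpen` of `Motives/SeesawGrauertGluing`) need exactly this
functoriality. This file re-runs the construction keeping the maps:

* `piScalarRight_rTensor` — the identification `B ⊗_A A^m ≅ B^m` (Mathlib
  `TensorProduct.piScalarRight`) is natural in the algebra `B`;
* `exists_matrix_kerEquiv_baseChange_natural` — there are `M` and, for every `B`, a `B`-linear
  isomorphism `ε_B : Ker(M ⊗ B) ≅ Ker(d ⊗ B)` (`v ↦ (π₀ ⊗ B)(e_B⁻¹ v)` for a presentation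
  `π₀ : A^m ↠ P₀` with section `s₀`), such that for every `A`-algebra homomorphism `u : B → B'`
  and `v ∈ Ker(M ⊗ B)`, `ε_{B'}(u ∘ v) = (u ⊗ 1)(ε_B v)`.

Pure linear algebra (Mathlib: `Module.Finite.exists_fin'`, `Module.projective_lifting_property`,
`TensorProduct.piScalarRight`, `LinearMap.baseChange`, `LinearMap.rTensor`).

## References

* U. Görtz, T. Wedhorn, *Algebraic Geometry II: Cohomology of Schemes*, Springer Spektrum (2023),
  doi:10.1007/978-3-658-43031-3: Prop. 22.53, p. 360; proof of Prop. 23.117, p. 466; Cor. 23.137,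
  p. 480. [GortzWedhorn2023]
* D. Mumford, *Abelian Varieties*, TIFR Studies in Mathematics 5 (1970), §5. [MumfordAV1970]
-/

universe u v w

open TensorProduct
open scoped Matrix

noncomputable section

namespace Literature.AlgebraicGeometry.Motives

/-! ### Naturality of `B ⊗_A A^m ≅ B^m` and of base change in the algebra -/

section Naturality

variable {A : Type u} [CommRing A] {B : Type v} [CommRing B] [Algebra A B]
  {B' : Type w} [CommRing B'] [Algebra A B'] (u : B →ₐ[A] B')

/-- **`B ⊗_A A^m ≅ B^m` is natural in `B`**: for an `A`-algebra homomorphism `u : B → B'`,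
`e_{B'} ((u ⊗ 1) z) = u ∘ e_B z` (`e` = Mathlib `TensorProduct.piScalarRight`). [folklore] -/
theorem piScalarRight_rTensor {m : ℕ} (z : B ⊗[A] (Fin m → A)) :
    TensorProduct.piScalarRight A B' B' (Fin m) (u.toLinearMap.rTensor (Fin m → A) z) =
      fun i => u (TensorProduct.piScalarRight A B B (Fin m) z i) := by
  induction z using TensorProduct.induction_on with
  | zero =>
    simp only [map_zero]
    funext i
    simp
  | add x y hx hy =>
    simp only [map_add, hx, hy]
    funext i
    simp
  | tmul b f =>
    rw [LinearMap.rTensor_tmul]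
    simp only [TensorProduct.piScalarRight_apply, TensorProduct.piScalarRightHom_tmul]
    funext i
    rw [AlgHom.toLinearMap_apply, map_smul]

/-- **Base change is natural in the algebra**: `(u ⊗ 1) ((f ⊗ B) z) = (f ⊗ B') ((u ⊗ 1) z)`.
[folklore] -/
theorem rTensor_baseChange {M N : Type*} [AddCommGroup M] [Module A M] [AddCommGroup N]
    [Module A N] (f : M →ₗ[A] N) (z : B ⊗[A] M) :
    u.toLinearMap.rTensor N (f.baseChange B z) = f.baseChange B' (u.toLinearMap.rTensor M z) := by
  induction z using TensorProduct.induction_on with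
  | zero => simp
  | add x y hx hy => simp only [map_add, hx, hy]
  | tmul b m => simp [LinearMap.baseChange_tmul, LinearMap.rTensor_tmul]

end Naturality

/-! ### The matrix of a map of finite projective modules, with natural kernel isomorphisms -/

section Projective

variable {A : Type u} [CommRing A] {P₀ : Type v} {P₁ : Type w}
  [AddCommGroup P₀] [Module A P₀] [AddCommGroup P₁] [Module A P₁]
  [Module.Finite A P₀] [Module.Projective A P₀] [Module.Finite A P₁] [Module.Projective A P₁]

/-- **The kernels of all base changes of a map of finite projective modules are the kernels of
one matrix, naturally in the algebra** (Görtz–Wedhorn II, Cor. 23.137: isomorphisms "functorial in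
the `A`-algebra `B`"; the matrix is the one of `exists_matrix_forall_ker_equiv_ker_baseChange`:
`P₀`, `P₁` are direct summands of `A^m`, `A^{n'}` via `π₀ s₀ = 1`, `π₁ s₁ = 1`, and
`M = [s₁ d π₀ ; 1 - s₀ π₀]`). For `d : P₀ → P₁` linear between finitely generated projective
`A`-modules there are `M ∈ M_{n × m}(A)` and `B`-linear isomorphisms
`ε_B : Ker(M ⊗ B : B^m → B^n) ≅ Ker(d ⊗ B)` for all commutative `A`-algebras `B`, given by
`v ↦ (π₀ ⊗ B)(e_B⁻¹ v)` (`e_B : B ⊗_A A^m ≅ B^m`), such that `ε_{B'} v' = (u ⊗ 1)(ε_B v)` whenever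
`u : B → B'` is an `A`-algebra homomorphism and `v' = u ∘ v`.
[cite: GortzWedhorn2023, Cor. 23.137 (p. 480) with Prop. 23.117, proof (p. 466)] -/
theorem exists_matrix_kerEquiv_baseChange_natural (d : P₀ →ₗ[A] P₁) :
    ∃ (m n : ℕ) (M : Matrix (Fin n) (Fin m) A)
      (ε : ∀ (B : Type u) [CommRing B] [Algebra A B],
        LinearMap.ker (M.map (algebraMap A B)).mulVecLin ≃ₗ[B] LinearMap.ker (d.baseChange B)),
      ∀ (B : Type u) [CommRing B] [Algebra A B] (B' : Type u) [CommRing B'] [Algebra A B']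
        (u : B →ₐ[A] B') (v : LinearMap.ker (M.map (algebraMap A B)).mulVecLin)
        (v' : LinearMap.ker (M.map (algebraMap A B')).mulVecLin),
        (∀ i, (v' : Fin m → B') i = u ((v : Fin m → B) i)) →
          ((ε B' v' : LinearMap.ker (d.baseChange B')) : B' ⊗[A] P₀) =
            u.toLinearMap.rTensor P₀ ((ε B v : LinearMap.ker (d.baseChange B)) : B ⊗[A] P₀) := by
  classical
  obtain ⟨m, π₀, hπ₀⟩ := Module.Finite.exists_fin' A P₀
  obtain ⟨s₀, hs₀⟩ := Module.projective_lifting_property π₀ (LinearMap.id : P₀ →ₗ[A] P₀) hπ₀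
  obtain ⟨n, π₁, hπ₁⟩ := Module.Finite.exists_fin' A P₁
  obtain ⟨s₁, hs₁⟩ := Module.projective_lifting_property π₁ (LinearMap.id : P₁ →ₗ[A] P₁) hπ₁
  -- the two blocks `s₁ d π₀ : A^m → A^n` and `1 - s₀ π₀ : A^m → A^m`, as matrices
  set G₁ : (Fin m → A) →ₗ[A] (Fin n → A) := s₁ ∘ₗ d ∘ₗ π₀ with hG₁
  set G₂ : (Fin m → A) →ₗ[A] (Fin m → A) := LinearMap.id - s₀ ∘ₗ π₀ with hG₂
  set N : Matrix (Fin n) (Fin m) A := LinearMap.toMatrix' G₁ with hN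
  set Q : Matrix (Fin m) (Fin m) A := LinearMap.toMatrix' G₂ with hQ
  set M : Matrix (Fin (n + m)) (Fin m) A := (Matrix.fromRows N Q).submatrix finSumFinEquiv.symm id
    with hM
  -- membership in `Ker(M ⊗ B)` is the pair of conditions `N ⊗ B v = 0`, `Q ⊗ B v = 0`
  have hker : ∀ (B : Type u) [CommRing B] [Algebra A B] (v : Fin m → B),
      v ∈ LinearMap.ker (M.map (algebraMap A B)).mulVecLin ↔
        (N.map (algebraMap A B)) *ᵥ v = 0 ∧ (Q.map (algebraMap A B)) *ᵥ v = 0 := by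
    intro B _ _ v
    have e : LinearMap.ker (M.map (algebraMap A B)).mulVecLin =
        LinearMap.ker (N.map (algebraMap A B)).mulVecLin ⊓
          LinearMap.ker (Q.map (algebraMap A B)).mulVecLin := by
      rw [hM, ← Matrix.submatrix_map, ker_mulVecLin_submatrix_equiv, Matrix.fromRows_map,
        ker_mulVecLin_fromRows]
    rw [e, Submodule.mem_inf, LinearMap.mem_ker, LinearMap.mem_ker, Matrix.mulVecLin_apply,
      Matrix.mulVecLin_apply]
  -- the split data after base change
  have h₀ : ∀ (B : Type u) [CommRing B] [Algebra A B] (p : B ⊗[A] P₀),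
      π₀.baseChange B (s₀.baseChange B p) = p := by
    intro B _ _ p
    rw [← LinearMap.comp_apply, ← LinearMap.baseChange_comp, hs₀, LinearMap.baseChange_id,
      LinearMap.id_apply]
  have h₁ : ∀ (B : Type u) [CommRing B] [Algebra A B],
      Function.Injective (s₁.baseChange B) := by
    intro B _ _ p q hpq
    have := congr_arg (π₁.baseChange B) hpq
    rwa [← LinearMap.comp_apply, ← LinearMap.comp_apply, ← LinearMap.baseChange_comp, hs₁,
      LinearMap.baseChange_id, LinearMap.id_apply, LinearMap.id_apply] at this
  have hG₁B : ∀ (B : Type u) [CommRing B] [Algebra A B] (z : B ⊗[A] (Fin m → A)),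
      G₁.baseChange B z = s₁.baseChange B (d.baseChange B (π₀.baseChange B z)) := by
    intro B _ _ z
    rw [hG₁, LinearMap.baseChange_comp, LinearMap.baseChange_comp]
    rfl
  have hG₂B : ∀ (B : Type u) [CommRing B] [Algebra A B] (z : B ⊗[A] (Fin m → A)),
      G₂.baseChange B z = z - s₀.baseChange B (π₀.baseChange B z) := by
    intro B _ _ z
    rw [hG₂, LinearMap.baseChange_sub, LinearMap.baseChange_id, LinearMap.baseChange_comp]
    rfl
  -- `e (G ⊗ B z) = (matrix of G) ⊗ B *ᵥ e z`
  have hN : ∀ (B : Type u) [CommRing B] [Algebra A B] (z : B ⊗[A] (Fin m → A)),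
      TensorProduct.piScalarRight A B B (Fin n) (G₁.baseChange B z) =
        (N.map (algebraMap A B)) *ᵥ (TensorProduct.piScalarRight A B B (Fin m) z) := by
    intro B _ _ z
    rw [piScalarRight_baseChange_toLin']
    rfl
  have hQ : ∀ (B : Type u) [CommRing B] [Algebra A B] (z : B ⊗[A] (Fin m → A)),
      TensorProduct.piScalarRight A B B (Fin m) (G₂.baseChange B z) =
        (Q.map (algebraMap A B)) *ᵥ (TensorProduct.piScalarRight A B B (Fin m) z) := by
    intro B _ _ z
    rw [piScalarRight_baseChange_toLin']
    rfl
  -- the two directions, for `v ∈ Ker(M ⊗ B)` with `z = e⁻¹ v`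
  have hfwd : ∀ (B : Type u) [CommRing B] [Algebra A B]
      (v : LinearMap.ker (M.map (algebraMap A B)).mulVecLin),
      d.baseChange B (π₀.baseChange B
        ((TensorProduct.piScalarRight A B B (Fin m)).symm (v : Fin m → B))) = 0 := by
    intro B _ _ v
    obtain ⟨hvN, -⟩ := (hker B v).1 v.2
    set z := (TensorProduct.piScalarRight A B B (Fin m)).symm (v : Fin m → B) with hz
    have hz' : TensorProduct.piScalarRight A B B (Fin m) z = v := by
      rw [hz, LinearEquiv.apply_symm_apply]
    have hG : G₁.baseChange B z = 0 := by
      apply (TensorProduct.piScalarRight A B B (Fin n)).injective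
      rw [hN, hz', hvN, map_zero]
    apply h₁ B
    rw [← hG₁B, hG, map_zero]
  have hfix : ∀ (B : Type u) [CommRing B] [Algebra A B]
      (v : LinearMap.ker (M.map (algebraMap A B)).mulVecLin),
      s₀.baseChange B (π₀.baseChange B
        ((TensorProduct.piScalarRight A B B (Fin m)).symm (v : Fin m → B))) =
        (TensorProduct.piScalarRight A B B (Fin m)).symm (v : Fin m → B) := by
    intro B _ _ v
    obtain ⟨-, hvQ⟩ := (hker B v).1 v.2
    set z := (TensorProduct.piScalarRight A B B (Fin m)).symm (v : Fin m → B) with hz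
    have hz' : TensorProduct.piScalarRight A B B (Fin m) z = v := by
      rw [hz, LinearEquiv.apply_symm_apply]
    have hG : G₂.baseChange B z = 0 := by
      apply (TensorProduct.piScalarRight A B B (Fin m)).injective
      rw [hQ, hz', hvQ, map_zero]
    rw [hG₂B, sub_eq_zero] at hG
    exact hG.symm
  have hbwd : ∀ (B : Type u) [CommRing B] [Algebra A B] (p : LinearMap.ker (d.baseChange B)),
      TensorProduct.piScalarRight A B B (Fin m) (s₀.baseChange B (p : B ⊗[A] P₀)) ∈
        LinearMap.ker (M.map (algebraMap A B)).mulVecLin := by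
    intro B _ _ p
    have hp : d.baseChange B (p : B ⊗[A] P₀) = 0 := p.2
    rw [hker]
    constructor
    · rw [← hN, hG₁B, h₀, hp, map_zero, map_zero]
    · rw [← hQ, hG₂B, h₀, sub_self, map_zero]
  -- the equivalences
  let ε : ∀ (B : Type u) [CommRing B] [Algebra A B],
      LinearMap.ker (M.map (algebraMap A B)).mulVecLin ≃ₗ[B] LinearMap.ker (d.baseChange B) :=
    fun B _ _ =>
    { toFun := fun v => ⟨π₀.baseChange B
          ((TensorProduct.piScalarRight A B B (Fin m)).symm (v : Fin m → B)), hfwd B v⟩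
      invFun := fun p => ⟨TensorProduct.piScalarRight A B B (Fin m)
          (s₀.baseChange B (p : B ⊗[A] P₀)), hbwd B p⟩
      map_add' := fun v w => by
        apply Subtype.ext
        simp only [Submodule.coe_add, map_add]
      map_smul' := fun c v => by
        apply Subtype.ext
        simp only [SetLike.val_smul, map_smul, RingHom.id_apply]
      left_inv := fun v => by
        apply Subtype.ext
        change TensorProduct.piScalarRight A B B (Fin m) (s₀.baseChange B (π₀.baseChange B
          ((TensorProduct.piScalarRight A B B (Fin m)).symm (v : Fin m → B)))) = v
        rw [hfix, LinearEquiv.apply_symm_apply]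
      right_inv := fun p => by
        apply Subtype.ext
        change π₀.baseChange B ((TensorProduct.piScalarRight A B B (Fin m)).symm
          (TensorProduct.piScalarRight A B B (Fin m) (s₀.baseChange B (p : B ⊗[A] P₀)))) = p
        rw [LinearEquiv.symm_apply_apply, h₀] }
  refine ⟨m, n + m, M, ε, ?_⟩
  -- naturality
  intro B _ _ B' _ _ u v v' hv
  change π₀.baseChange B' ((TensorProduct.piScalarRight A B' B' (Fin m)).symm (v' : Fin m → B')) =
    u.toLinearMap.rTensor P₀ (π₀.baseChange B
      ((TensorProduct.piScalarRight A B B (Fin m)).symm (v : Fin m → B)))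
  rw [rTensor_baseChange]
  congr 1
  apply (TensorProduct.piScalarRight A B' B' (Fin m)).injective
  rw [LinearEquiv.apply_symm_apply, piScalarRight_rTensor, LinearEquiv.apply_symm_apply]
  funext i
  exact hv i

end Projective

end Literature.AlgebraicGeometry.Motives

end
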